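import Literature.Probability.LatticeModels.PlanarIsingOnePoint
import HarnessLib

/-!
# Connectivity of the polygonal domain forces lattice connectivity of the free sites

Topic `Literature/Probability/LatticeModels`. A topological bridge of the programme behind
`Literature.Probability.LatticeModels.chi_onePoint_rho`: CHI's approximation hypothesis
`MeshApproximates` (`PlanarIsingOnePoint.lean`) speaks about the polygon
`meshPolygon Λ δ = interior (⋃_{x ∈ Λ} meshCell δ x)` of the free sites, whereas the lattice
constructions (`IsingDisorderLaplacian.exists_isKCCuts_plus`, `PlaquetteConnectivity.lean`) need
connectivity of `Λ` through lattice bonds. This file proves: for `δ > 0` and finite `Λ`, if the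
polygon is preconnected then `Λ` induces a preconnected subgraph of `ℤ²`
(`induce_preconnected_of_isPreconnected_meshPolygon`). Ingredients: the elementary geometry of the
square tiling — (K) a point of a cell of a site outside `S` is not interior to the union of the cells
of `S` (`not_mem_interior_of_mem_meshCell`), (K') a point all of whose cells belong to `S` is
interior (`mem_interior_of_forall_meshCell`), cells sharing a point have indices differing by at most
one — and the observation that two cells of the two parts of a bond-disconnected `Λ` can only meet
at a corner whose two other cells would reconnect the parts. Everything proved; no named facts.

## References

* D. Chelkak, C. Hongler, K. Izyurov, Ann. of Math. 181 (2015) = arXiv:1202.2838, §2.1 (discrete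
  domains as unions of faces; "simply connected if the polygonal domain is") —
  `ChelkakHonglerIzyurovAnnals2015`.
-/

noncomputable section

open MeasureTheory Finset Filter

namespace Literature.Probability.LatticeModels

/-! ## Cells containing a point -/

section Cells

open Complex Metric Set

variable {δ : ℝ}

/-- Two cells whose first (resp. second) index differ by `≥ 2` have no common point: indices of
cells containing a common point differ by at most one in each coordinate. [folklore] -/
theorem abs_sub_le_one_of_mem_meshCell (hδ : 0 < δ) {z : ℂ} {x y : Site 2} (hx : z ∈ meshCell δ x)
    (hy : z ∈ meshCell δ y) (j : Fin 2) : |x j - y j| ≤ 1 := by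
  have key : ∀ {t : ℝ} {m n : ℤ}, |t - δ * m| ≤ δ / 2 → |t - δ * n| ≤ δ / 2 → |(m : ℤ) - n| ≤ 1 := by
    intro t m n hm hn
    have h1 : |δ * m - δ * n| ≤ δ := by
      calc |δ * m - δ * n| = |(t - δ * n) - (t - δ * m)| := by ring_nf
        _ ≤ |t - δ * n| + |t - δ * m| := abs_sub _ _
        _ ≤ δ := by linarith
    rw [← mul_sub, abs_mul, abs_of_pos hδ] at h1
    have h2 : |(m : ℝ) - n| ≤ 1 := by
      by_contra h; push Not at h; nlinarith
    rw [← Int.cast_sub, ← Int.cast_abs] at h2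
    exact_mod_cast h2
  fin_cases j
  · exact key hx.1 hy.1
  · exact key hx.2 hy.2

/-- The open cell of `y` meets no other closed cell. [folklore] -/
theorem eq_of_mem_openCell_of_mem_meshCell (hδ : 0 < δ) {w : ℂ} {x y : Site 2}
    (hy : |w.re - δ * y 0| < δ / 2 ∧ |w.im - δ * y 1| < δ / 2) (hx : w ∈ meshCell δ x) : x = y := by
  have key : ∀ {t : ℝ} {m n : ℤ}, |t - δ * m| < δ / 2 → |t - δ * n| ≤ δ / 2 → n = m := by
    intro t m n hm hn
    have h1 : |δ * m - δ * n| < δ := by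
      calc |δ * m - δ * n| = |(t - δ * n) - (t - δ * m)| := by ring_nf
        _ ≤ |t - δ * n| + |t - δ * m| := abs_sub _ _
        _ < δ := by linarith
    rw [← mul_sub, abs_mul, abs_of_pos hδ] at h1
    have h2 : |(m : ℝ) - n| < 1 := by nlinarith
    rw [← Int.cast_sub, ← Int.cast_abs] at h2
    have h3 : |m - n| < 1 := by exact_mod_cast h2
    have := abs_lt.1 h3
    omega
  rw [funext_iff, Fin.forall_fin_two]
  exact ⟨key hy.1 hx.1, key hy.2 hx.2⟩

/-- Every point lies in the cell of the rounded coordinates. [folklore] -/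
theorem mem_meshCell_round (hδ : 0 < δ) (w : ℂ) : w ∈ meshCell δ ![round (w.re / δ), round (w.im / δ)] := by
  have key : ∀ t : ℝ, |t - δ * round (t / δ)| ≤ δ / 2 := by
    intro t
    have h := abs_sub_round (t / δ)
    have : t - δ * round (t / δ) = δ * (t / δ - round (t / δ)) := by field_simp
    rw [this, abs_mul, abs_of_pos hδ]
    nlinarith
  exact ⟨by simpa using key w.re, by simpa using key w.im⟩

/-- **(K)** A point of a cell of a site outside `S` is not interior to the union of the cells of `S`
(points of the open cell of that site approach it and lie in no other cell). [folklore] -/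
theorem not_mem_interior_of_mem_meshCell (hδ : 0 < δ) {S : Set (Site 2)} {z : ℂ} {y : Site 2}
    (hz : z ∈ meshCell δ y) (hy : y ∉ S) : z ∉ interior (⋃ x ∈ S, meshCell δ x) := by
  intro hint
  obtain ⟨ε, hε, hball⟩ := Metric.isOpen_iff.1 isOpen_interior z hint
  -- move a little from `z` towards the centre of the cell of `y`
  set c : ℂ := meshPoint δ y with hc
  set t : ℝ := min 1 (ε / (2 * (‖c - z‖ + 1))) with ht
  have ht0 : 0 < t := lt_min one_pos (by positivity)
  have ht1 : t ≤ 1 := min_le_left _ _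
  set w : ℂ := z + (t : ℂ) * (c - z) with hw
  have hwz : dist w z < ε := by
    rw [dist_eq_norm, hw, add_sub_cancel_left, norm_mul, Complex.norm_real, Real.norm_eq_abs, abs_of_pos ht0]
    have h1 : t * (‖c - z‖ + 1) ≤ ε / 2 := by
      have : t ≤ ε / (2 * (‖c - z‖ + 1)) := min_le_right _ _
      rw [le_div_iff₀ (by positivity)] at this; linarith
    nlinarith [norm_nonneg (c - z)]
  have hwU : w ∈ ⋃ x ∈ S, meshCell δ x := interior_subset (hball hwz)
  simp only [Set.mem_iUnion] at hwU
  obtain ⟨x, hxS, hwx⟩ := hwU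
  -- `w` lies in the open cell of `y`
  have hopen : |w.re - δ * y 0| < δ / 2 ∧ |w.im - δ * y 1| < δ / 2 := by
    have hre : w.re - δ * y 0 = (1 - t) * (z.re - δ * y 0) := by
      rw [hw, hc]; simp [meshPoint_re]; ring
    have him : w.im - δ * y 1 = (1 - t) * (z.im - δ * y 1) := by
      rw [hw, hc]; simp [meshPoint_im]; ring
    rw [hre, him, abs_mul, abs_mul, abs_of_nonneg (by linarith : (0 : ℝ) ≤ 1 - t)]
    have hδ2 : 0 < δ / 2 := by positivity
    constructor <;> nlinarith [hz.1, hz.2, abs_nonneg (z.re - δ * y 0), abs_nonneg (z.im - δ * y 1)]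
  exact hy (eq_of_mem_openCell_of_mem_meshCell hδ hopen hwx ▸ hxS)

/-- One-dimensional stability of cell indices: near `t`, points belong only to cells containing `t`.
[folklore] -/
theorem exists_pos_forall_cellIdx_subset (hδ : 0 < δ) (t : ℝ) :
    ∃ ρ > 0, ∀ s : ℝ, |s - t| < ρ → ∀ m : ℤ, |s - δ * m| ≤ δ / 2 → |t - δ * m| ≤ δ / 2 := by
  -- the cell boundaries are the points `δ (k + 1/2)`; take `ρ` = distance to the nearest one ≠ t,
  -- concretely `ρ = min over the two boundaries adjacent to t not equal to t`, or `δ/2` if `t` is one.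
  set m₀ : ℤ := round (t / δ) with hm₀
  have hm : |t - δ * m₀| ≤ δ / 2 := by
    have h := abs_sub_round (t / δ)
    have : t - δ * round (t / δ) = δ * (t / δ - round (t / δ)) := by field_simp
    rw [this, abs_mul, abs_of_pos hδ]; nlinarith
  -- distances to the two boundaries of the cell `m₀`
  set d₁ : ℝ := t - (δ * m₀ - δ / 2) with hd₁
  set d₂ : ℝ := (δ * m₀ + δ / 2) - t with hd₂
  have hd₁0 : 0 ≤ d₁ := by rw [hd₁]; linarith [(abs_le.1 hm).1]
  have hd₂0 : 0 ≤ d₂ := by rw [hd₂]; linarith [(abs_le.1 hm).2]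
  -- ρ: the positive ones among d₁, d₂, and δ (as a fallback when a distance vanishes)
  refine ⟨min (if d₁ = 0 then δ else d₁) (if d₂ = 0 then δ else d₂), ?_, ?_⟩
  · refine lt_min ?_ ?_ <;> split_ifs with h
    · exact hδ
    · exact lt_of_le_of_ne hd₁0 (Ne.symm h)
    · exact hδ
    · exact lt_of_le_of_ne hd₂0 (Ne.symm h)
  intro s hs m hsm
  have hs1 : |s - t| < (if d₁ = 0 then δ else d₁) := lt_of_lt_of_le hs (min_le_left _ _)
  have hs2 : |s - t| < (if d₂ = 0 then δ else d₂) := lt_of_lt_of_le hs (min_le_right _ _)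
  obtain ⟨hsm1, hsm2⟩ := abs_le.1 hsm
  obtain ⟨hst1, hst2⟩ := abs_lt.1 hs
  rw [abs_le]
  -- compare the integers `m` and `m₀`
  rcases lt_trichotomy m m₀ with hlt | rfl | hgt
  · -- `m ≤ m₀ - 1`: then `s ≤ δ m + δ/2 ≤ δ m₀ - δ/2 = t - d₁`
    have hle : (m : ℝ) ≤ m₀ - 1 := by exact_mod_cast Int.le_sub_one_of_lt hlt
    have hs_le : s ≤ δ * m₀ - δ / 2 := by nlinarith
    split_ifs at hs1 with h0
    · -- `d₁ = 0`: `t` is the lower boundary of cell `m₀`, i.e. the upper boundary of cell `m₀ - 1`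
      have ht : t = δ * m₀ - δ / 2 := by rw [hd₁] at h0; linarith
      have hm1 : (m : ℝ) = m₀ - 1 := by
        by_contra hne
        have h2 : (m : ℝ) ≤ m₀ - 2 := by
          have : m ≤ m₀ - 2 := by
            rcases lt_or_eq_of_le (Int.le_sub_one_of_lt hlt) with h | h
            · omega
            · exact absurd (by exact_mod_cast h) hne
          exact_mod_cast this
        have h3 : δ * m ≤ δ * (m₀ - 2) := mul_le_mul_of_nonneg_left h2 hδ.le
        have h4 := (abs_lt.1 hs1).1
        nlinarith
      rw [hm1, ht]; constructor <;> nlinarith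
    · exfalso
      have h4 := (abs_lt.1 hs1).1
      rw [hd₁] at h4; nlinarith
  · exact abs_le.1 hm
  · have hle : (m₀ : ℝ) + 1 ≤ m := by exact_mod_cast Int.add_one_le_of_lt hgt
    have hs_ge : δ * m₀ + δ / 2 ≤ s := by nlinarith
    split_ifs at hs2 with h0
    · have ht : t = δ * m₀ + δ / 2 := by rw [hd₂] at h0; linarith
      have hm1 : (m : ℝ) = m₀ + 1 := by
        by_contra hne
        have h2 : (m₀ : ℝ) + 2 ≤ m := by
          have : m₀ + 2 ≤ m := by
            rcases lt_or_eq_of_le (Int.add_one_le_of_lt hgt) with h | h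
            · omega
            · exact absurd (by exact_mod_cast h.symm) hne
          exact_mod_cast this
        have h3 : δ * (m₀ + 2) ≤ δ * m := mul_le_mul_of_nonneg_left h2 hδ.le
        have h4 := (abs_lt.1 hs2).2
        nlinarith
      rw [hm1, ht]; constructor <;> nlinarith
    · exfalso
      have h4 := (abs_lt.1 hs2).2
      rw [hd₂] at h4; nlinarith

/-- **(K')** If every cell containing `z` belongs to `S`, then `z` is interior to the union of the
cells of `S`. [folklore] -/
theorem mem_interior_of_forall_meshCell (hδ : 0 < δ) {S : Set (Site 2)} {z : ℂ}
    (h : ∀ x : Site 2, z ∈ meshCell δ x → x ∈ S) : z ∈ interior (⋃ x ∈ S, meshCell δ x) := by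
  obtain ⟨ρ₁, hρ₁, h₁⟩ := exists_pos_forall_cellIdx_subset hδ z.re
  obtain ⟨ρ₂, hρ₂, h₂⟩ := exists_pos_forall_cellIdx_subset hδ z.im
  rw [mem_interior]
  refine ⟨ball z (min ρ₁ ρ₂), ?_, isOpen_ball, mem_ball_self (lt_min hρ₁ hρ₂)⟩
  intro w hw
  rw [mem_ball, dist_eq_norm] at hw
  have hre : |w.re - z.re| < ρ₁ :=
    lt_of_le_of_lt (by simpa using abs_re_le_norm (w - z)) (lt_of_lt_of_le hw (min_le_left _ _))
  have him : |w.im - z.im| < ρ₂ :=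
    lt_of_le_of_lt (by simpa using abs_im_le_norm (w - z)) (lt_of_lt_of_le hw (min_le_right _ _))
  have hwx := mem_meshCell_round hδ w
  set x : Site 2 := ![round (w.re / δ), round (w.im / δ)]
  have hzx : z ∈ meshCell δ x := ⟨h₁ w.re hre (x 0) hwx.1, h₂ w.im him (x 1) hwx.2⟩
  simp only [Set.mem_iUnion]
  exact ⟨x, h x hzx, hwx⟩

/-- The centre of a cell is interior to the union of cells of any set containing its site.
[folklore] -/
theorem meshPoint_mem_interior (hδ : 0 < δ) {S : Set (Site 2)} {x : Site 2} (hx : x ∈ S) :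
    meshPoint δ x ∈ interior (⋃ y ∈ S, meshCell δ y) := by
  apply mem_interior_of_forall_meshCell hδ
  intro y hy
  have hopen : |(meshPoint δ x).re - δ * x 0| < δ / 2 ∧ |(meshPoint δ x).im - δ * x 1| < δ / 2 := by
    simp [meshPoint_re, meshPoint_im]; positivity
  rw [eq_of_mem_openCell_of_mem_meshCell hδ hopen hy]; exact hx

end Cells

/-! ## Connectivity of the polygon forces lattice connectivity of the sites -/

section PolygonConnectivity

open Complex Metric Set SimpleGraph

/-- Sites reachable from `x` through lattice bonds inside `Λ`. [folklore] -/
def LatticeReach (Λ : Finset (Site 2)) (x a : Site 2) : Prop :=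
  ∃ W : (zdGraph 2).Walk x a, ∀ z ∈ W.support, z ∈ Λ

/-- Reachability inside `Λ` extends across a lattice bond into `Λ`. [folklore] -/
theorem LatticeReach.step {Λ : Finset (Site 2)} {x a b : Site 2} (h : LatticeReach Λ x a)
    (hab : (zdGraph 2).Adj a b) (hb : b ∈ Λ) : LatticeReach Λ x b := by
  obtain ⟨W, hW⟩ := h
  refine ⟨W.append (Walk.cons hab Walk.nil), ?_⟩
  intro z hz
  rw [Walk.support_append, List.mem_append] at hz
  rcases hz with hz | hz
  · exact hW z hz
  · simp only [Walk.support_cons, Walk.support_nil, List.tail_cons, List.mem_singleton] at hz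
    exact hz ▸ hb

/-- Reachability inside `Λ` gives reachability in the induced subgraph. [folklore] -/
theorem LatticeReach.reachable_induce {Λ : Finset (Site 2)} {x a : Site 2} (hx : x ∈ Λ) (ha : a ∈ Λ)
    (h : LatticeReach Λ x a) : ((zdGraph 2).induce (↑Λ : Set (Site 2))).Reachable ⟨x, hx⟩ ⟨a, ha⟩ := by
  obtain ⟨W, hW⟩ := h
  induction W with
  | nil => exact Reachable.refl _
  | @cons u v w hadj W ih =>
    have hv : v ∈ Λ := hW v (by simp)
    have h1 : ((zdGraph 2).induce (↑Λ : Set (Site 2))).Adj ⟨u, hx⟩ ⟨v, hv⟩ := hadj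
    exact h1.reachable.trans (ih hv ha fun z hz => hW z (by simp [hz]))

/-- **Connectivity of the polygonal domain forces connectivity of the sites**: for `δ > 0` and a
finite set of sites `Λ`, if the polygon `meshPolygon Λ δ` (interior of the union of the closed
cells) is preconnected, then `Λ` induces a preconnected subgraph of `ℤ²`. (Cells of non-adjacent
sites meet at most in a corner, which is not an interior point of the union unless all four cells
around it are present.) With `MeshApproximates` this feeds `usable_connectivity_of_preconnected`.
[cite: ChelkakHonglerIzyurovAnnals2015, §2.1] -/
theorem induce_preconnected_of_isPreconnected_meshPolygon {δ : ℝ} (hδ : 0 < δ) {Λ : Finset (Site 2)}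
    (hP : IsPreconnected (meshPolygon (↑Λ : Set (Site 2)) δ)) :
    ((zdGraph 2).induce (↑Λ : Set (Site 2))).Preconnected := by
  classical
  rintro ⟨x, hx⟩ ⟨y, hy⟩
  -- the part of `Λ` reachable from `x` inside `Λ`, and the rest
  set A : Finset (Site 2) := Λ.filter fun a => LatticeReach Λ x a with hA
  set B : Finset (Site 2) := Λ.filter fun a => ¬ LatticeReach Λ x a with hB
  have hxΛ : x ∈ Λ := hx
  have hxA : x ∈ A := Finset.mem_filter.2 ⟨hxΛ, Walk.nil, fun z hz => by simp at hz; exact hz ▸ hxΛ⟩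
  by_cases hyA : y ∈ A
  · exact LatticeReach.reachable_induce hx hy (Finset.mem_filter.1 hyA).2
  exfalso
  have hyB : y ∈ B := Finset.mem_filter.2 ⟨hy, fun h => hyA (Finset.mem_filter.2 ⟨hy, h⟩)⟩
  -- closure of `A` under lattice bonds inside `Λ`
  have hclosed : ∀ a ∈ A, ∀ b ∈ Λ, (zdGraph 2).Adj a b → b ∈ A := fun a ha b hb hab =>
    Finset.mem_filter.2 ⟨hb, (Finset.mem_filter.1 ha).2.step hab hb⟩
  -- the two open sets
  set UA : Set ℂ := interior (⋃ z ∈ (↑A : Set (Site 2)), meshCell δ z) with hUA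
  set UB : Set ℂ := interior (⋃ z ∈ (↑B : Set (Site 2)), meshCell δ z) with hUB
  have hΛAB : ∀ v ∈ Λ, v ∈ A ∨ v ∈ B := fun v hv => by
    by_cases h : LatticeReach Λ x v
    · exact Or.inl (Finset.mem_filter.2 ⟨hv, h⟩)
    · exact Or.inr (Finset.mem_filter.2 ⟨hv, h⟩)
  -- cover
  have hcover : meshPolygon (↑Λ : Set (Site 2)) δ ⊆ UA ∪ UB := by
    intro z hz
    have hall : ∀ v : Site 2, z ∈ meshCell δ v → v ∈ Λ := fun v hv => by
      by_contra hvΛ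
      exact not_mem_interior_of_mem_meshCell hδ (S := (↑Λ : Set (Site 2))) hv (by exact_mod_cast hvΛ) hz
    -- either all cells containing `z` are in `A`, or all are in `B`
    by_cases hex : ∃ v : Site 2, z ∈ meshCell δ v ∧ v ∈ A
    · obtain ⟨v, hzv, hvA⟩ := hex
      left
      apply mem_interior_of_forall_meshCell hδ
      intro u hzu
      rcases hΛAB u (hall u hzu) with huA | huB
      · exact huA
      · exfalso
        -- `u ∈ B`, `v ∈ A`, both cells contain `z`: they are equal, adjacent or diagonal
        have h0 := abs_sub_le_one_of_mem_meshCell hδ hzv hzu 0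
        have h1 := abs_sub_le_one_of_mem_meshCell hδ hzv hzu 1
        have huA' : ¬ LatticeReach Λ x u := (Finset.mem_filter.1 huB).2
        have huΛ : u ∈ Λ := (Finset.mem_filter.1 huB).1
        -- the intermediate site `m = (v 0, u 1)` also has a cell containing `z`
        set m : Site 2 := ![v 0, u 1] with hm
        have hzm : z ∈ meshCell δ m := ⟨by simpa [hm] using hzv.1, by simpa [hm] using hzu.2⟩
        have hmΛ := hall m hzm
        -- adjacency facts
        have adj_of : ∀ p q : Site 2, (|p 0 - q 0| = 1 ∧ p 1 = q 1) ∨ (p 0 = q 0 ∧ |p 1 - q 1| = 1) →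
            (zdGraph 2).Adj p q := by
          intro p q hpq
          rw [zdGraph_adj_iff]
          rcases hpq with ⟨h, h'⟩ | ⟨h, h'⟩
          · refine ⟨0, ?_⟩
            rcases abs_eq (zero_le_one' ℤ) |>.1 h with h1 | h1
            · right; rw [funext_iff, Fin.forall_fin_two]; simp; omega
            · left; rw [funext_iff, Fin.forall_fin_two]; simp; omega
          · refine ⟨1, ?_⟩
            rcases abs_eq (zero_le_one' ℤ) |>.1 h' with h1 | h1
            · right; rw [funext_iff, Fin.forall_fin_two]; simp; omega
            · left; rw [funext_iff, Fin.forall_fin_two]; simp; omega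
        have hm0 : m 0 = v 0 := by simp [hm]
        have hm1 : m 1 = u 1 := by simp [hm]
        -- `m ∈ A` (equal or adjacent to `v`)
        have hmA : m ∈ A := by
          by_cases hvm : v 1 = u 1
          · have : m = v := by rw [funext_iff, Fin.forall_fin_two]; exact ⟨hm0, hm1.trans hvm.symm⟩
            rw [this]; exact hvA
          · refine hclosed v hvA m hmΛ (adj_of v m (Or.inr ⟨hm0.symm, ?_⟩))
            rw [hm1]
            have : |v 1 - u 1| ≠ 0 := by rwa [Ne, abs_eq_zero, sub_eq_zero]
            have h1' : (0 : ℤ) ≤ |v 1 - u 1| := abs_nonneg _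
            omega
        -- then `u ∈ A` (equal or adjacent to `m`)
        apply huA'
        by_cases hum : v 0 = u 0
        · have : m = u := by rw [funext_iff, Fin.forall_fin_two]; exact ⟨hm0.trans hum, hm1⟩
          rw [← this]; exact (Finset.mem_filter.1 hmA).2
        · refine (Finset.mem_filter.1 (hclosed m hmA u huΛ (adj_of m u (Or.inl ⟨?_, hm1⟩)))).2
          rw [hm0]
          have : |v 0 - u 0| ≠ 0 := by rwa [Ne, abs_eq_zero, sub_eq_zero]
          have h0' : (0 : ℤ) ≤ |v 0 - u 0| := abs_nonneg _
          omega
    · right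
      push Not at hex
      apply mem_interior_of_forall_meshCell hδ
      intro u hzu
      rcases hΛAB u (hall u hzu) with huA | huB
      · exact absurd huA (hex u hzu)
      · exact huB
  -- both parts meet the polygon
  have hmeetA : (meshPolygon (↑Λ : Set (Site 2)) δ ∩ UA).Nonempty :=
    ⟨meshPoint δ x, meshPoint_mem_interior hδ (S := (↑Λ : Set (Site 2))) (by exact_mod_cast hx),
      meshPoint_mem_interior hδ (S := (↑A : Set (Site 2))) (by exact_mod_cast hxA)⟩
  have hmeetB : (meshPolygon (↑Λ : Set (Site 2)) δ ∩ UB).Nonempty :=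
    ⟨meshPoint δ y, meshPoint_mem_interior hδ (S := (↑Λ : Set (Site 2))) (by exact_mod_cast hy),
      meshPoint_mem_interior hδ (S := (↑B : Set (Site 2))) (by exact_mod_cast hyB)⟩
  -- but they are disjoint
  obtain ⟨z, -, hzA, hzB⟩ := hP UA UB isOpen_interior isOpen_interior hcover hmeetA hmeetB
  have hv := mem_meshCell_round hδ z
  set v : Site 2 := ![round (z.re / δ), round (z.im / δ)]
  have hvA : v ∈ A := by
    by_contra h
    exact not_mem_interior_of_mem_meshCell hδ (S := (↑A : Set (Site 2))) hv (by exact_mod_cast h) hzA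
  have hvB : v ∈ B := by
    by_contra h
    exact not_mem_interior_of_mem_meshCell hδ (S := (↑B : Set (Site 2))) hv (by exact_mod_cast h) hzB
  exact (Finset.mem_filter.1 hvB).2 (Finset.mem_filter.1 hvA).2

end PolygonConnectivity

end Literature.Probability.LatticeModels
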